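import Mathlib.Analysis.Fourier.Inversion
import Mathlib.MeasureTheory.Integral.ExpDecay
import Mathlib.MeasureTheory.Integral.IntegralEqImproper
import Mathlib.Analysis.SpecialFunctions.Pow.Asymptotics
import Literature.NumberTheory.LFunctions.XiIntegral
import Literature.NumberTheory.LFunctions.XiIntegralBridge
import Literature.NumberTheory.LFunctions.RiemannXiPrimitive
import Literature.NumberTheory.LFunctions.DeBruijnHZeroProofs
import Literature.NumberTheory.LFunctions.PolyaKernelRHProofs
import Literature.NumberTheory.LFunctions.ZetaFractionalPartIntegral
import Literature.Analysis.SpecialFunctions.GammaStirlingOrder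
import HarnessLib

/-!
# The integral of Riemann's `ξ`-function on the critical line — proof of LM Thm. 2.1 (1)

Companion ("Proofs") file of `XiIntegral.lean` (next to `XiIntegralProofs.lean` — Lemma 3.3 (1), §5 — and
`XiIntegralWintnerProofs.lean` — Wintner, Thm. 2.1 (2)), discharging the named fact
`Literature.NumberTheory.LFunctions.LagariasMontague2011_thm_2_1_i` (Lagarias–Montague 2011, Thm. 2.1 (1)
with `λ = 0`, eq. (2.6)):

  `lim_{t → ±∞} ξ^{(-1)}(½ + it) = ± i A₀`,  `A₀ = π Φ_T(0) = 2π Φ(0)` (`Φ = deBruijnPhi`),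

where `ξ^{(-1)}(s) = ∫_{1/2}^{s} ξ(w) dw` (`xiIntegral`) and `A₀ = xiIntegralLimit`.

## Proof

Lagarias–Montague (§4 of the paper) evaluate `lim_{T→∞} Ξ^{(-1)}(T)`, `Ξ^{(-1)}(T) = ∫₀ᵀ Ξ(t) dt
= 2∫₀^∞ Φ_T(u) (sin Tu)/u du`, by a Dirichlet-integral analysis at the point `u = 0`. We obtain the
same value from Mathlib's Fourier inversion theorem at the point `0`, which packages that analysis:

1. `fourier_deBruijnPhi` : `𝓕Φ(w) = ∫_ℝ Φ(u) e^{-2πiuw} du = ξ(½ + iπw)/4 = Ξ(πw)/4`, from the tree's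
   two-sided Laplace transform `∫_ℝ e^{zu}Φ(u) du = 2H₀(iz)` (`integral_exp_mul_deBruijnPhi`, Pólya;
   Titchmarsh §10.1) and `H₀(z) = ξ(½ + iz/2)/8` (`deBruijnH_zero_eq_holds`).
2. `integrable_riemannXi_criticalLine` : `t ↦ ξ(½ + it)` is integrable on `ℝ`; indeed
   `‖ξ(½+it)‖ ≤ 24π² (1+|t|)⁴ e^{-π|t|/4}` for `|t| ≥ 2` (`norm_riemannXi_criticalLine_le`), from
   `ξ = ½ s(s-1) π^{-s/2} Γ(s/2) ζ(s)`, the Stirling-order bound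
   `Literature.Analysis.SpecialFunctions.norm_Gamma_le_exp` and Titchmarsh (2.12.2)
   `‖ζ(s)‖ ≤ ‖s‖/‖s-1‖ + ‖s‖/σ` (`norm_riemannZeta_le_of_re_pos`).
3. `integral_riemannXi_criticalLine` : Fourier inversion at `0`
   (`MeasureTheory.Integrable.fourierInv_fourier_eq`; `Φ` is continuous and integrable) gives
   `Φ(0) = ∫_ℝ 𝓕Φ = (4π)⁻¹ ∫_ℝ Ξ`, i.e. `∫_ℝ Ξ(t) dt = 4πΦ(0)`; `Ξ` is even, so
   `∫₀^∞ Ξ = 2πΦ(0) = A₀` (`integral_riemannXi_criticalLine_Ioi`).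
4. `xiIntegral (½ + it) = i ∫₀ᵗ Ξ` (`xiIntegral_criticalLine`), and the improper-integral limit
   (`MeasureTheory.intervalIntegral_tendsto_integral_Ioi`) gives `t → +∞`; `t → -∞` follows since
   `Ξ` is even (`Ξ^{(-1)}` is odd).

As corollaries we also discharge the two parallel vendorings of the same statement:
`LagariasMontague2011_thm21_limit` (`XiPrimitive.lean`, through `XiIntegralBridge.lean`) and
`tendsto_riemannXiPrimitive_criticalLine_LM` (`RiemannXiPrimitive.lean`; its extra clause `A₀ ≠ 0`
holds because `A₀ = 2πΦ(0) > 0`, `deBruijnPhi_pos_holds`).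

## References

* J. C. Lagarias, D. Montague, *The integral of the Riemann ξ-function*, Comment. Math. Univ. St.
  Pauli 60 (2011), 143–169; arXiv:1106.4348, Thm. 2.1 (1), eq. (2.6), Lemma 3.1, §4.
* E. C. Titchmarsh, *The Theory of the Riemann Zeta-Function*, 2nd ed. (1986), §2.12, §10.1.
-/

noncomputable section

open Complex MeasureTheory Real Set Asymptotics
open _root_.Filter
open scoped _root_.Topology FourierTransform

namespace Literature.NumberTheory.LFunctions

/-! ## Step 1: the Fourier transform of `Φ` is `Ξ(π·)/4` -/

/-- **Pólya's Fourier representation of `Ξ`, Fourier-transform form**: for real `w`,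
`𝓕Φ(w) = ∫_ℝ Φ(u) e^{-2πiuw} du = ξ(½ + iπw)/4` (`Φ = deBruijnPhi`, Rodgers–Tao normalisation;
Titchmarsh (10.1.4) reads `Ξ(t) = 2∫₀^∞ Φ_T(u) cos(ut) du`, `Φ_T(u) = 2Φ(u/2)`).
[cite: Titchmarsh1986, §10.1 eqs. (10.1.3)–(10.1.4)] -/
theorem fourier_deBruijnPhi (w : ℝ) :
    𝓕 (fun u : ℝ ↦ (deBruijnPhi u : ℂ)) w = riemannXi (1 / 2 + ↑(π * w) * I) / 4 := by
  rw [fourier_real_eq_integral_exp_smul]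
  have h1 : ∀ v : ℝ, Complex.exp (↑(-2 * π * v * w) * I) • (deBruijnPhi v : ℂ) =
      Complex.exp ((-2 * π * w * I : ℂ) * v) * (deBruijnPhi v : ℂ) := by
    intro v
    rw [smul_eq_mul]
    congr 2
    push_cast
    ring
  simp_rw [h1]
  rw [integral_exp_mul_deBruijnPhi, deBruijnH_zero_eq_holds]
  have hI : I * (I * (-2 * ↑π * ↑w * I)) = 2 * ↑π * ↑w * I := by
    rw [show I * (I * (-2 * ↑π * ↑w * I)) = I ^ 2 * I * (-2 * ↑π * ↑w) by ring, I_sq]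
    ring
  have h2 : (1 / 2 + I * (I * (-2 * ↑π * ↑w * I)) / 2 : ℂ) = 1 / 2 + ↑(π * w) * I := by
    rw [hI]
    push_cast
    ring
  rw [h2]
  ring

/-! ## Step 2: `ξ` is integrable on the critical line -/

/-- **Size of `ξ` on the critical line**: for `|t| ≥ 2`,
`‖ξ(½ + it)‖ ≤ 24π² (1 + |t|)⁴ e^{-π|t|/4}`. From `ξ(s) = ½ s(s−1) π^{-s/2} Γ(s/2) ζ(s)`,
`‖Γ(¼ + it/2)‖ ≤ 16π²(1+|t|/2)^{1/2} e^{-π|t|/4}` (Stirling order) and Titchmarsh (2.12.2)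
`‖ζ(s)‖ ≤ ‖s‖/‖s−1‖ + ‖s‖/σ = 1 + 2‖s‖` on `σ = ½`. (Lagarias–Montague Lemma 3.3 (1) give the
sharper `O(e^{-π|t|/4}(|t|+1)^{5/2})` via the convexity bound.)
[cite: Titchmarsh1986, §2.12 eq. (2.12.2) and §4.12] -/
theorem norm_riemannXi_criticalLine_le {t : ℝ} (ht : 2 ≤ |t|) :
    ‖riemannXi (1 / 2 + t * I)‖ ≤ 24 * π ^ 2 * (1 + |t|) ^ 4 * Real.exp (-(π * |t|) / 4) := by
  set s : ℂ := 1 / 2 + t * I with hs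
  have hsre : s.re = 1 / 2 := by simp [hs]
  have hsim : s.im = t := by simp [hs]
  have hs0 : s ≠ 0 := fun h ↦ by rw [h] at hsre; simp at hsre
  have hs1 : s ≠ 1 := fun h ↦ by
    have := hsre; rw [h] at this; norm_num at this
  have hre : 0 < s.re := by rw [hsre]; norm_num
  -- the product formula
  have hΛ : completedRiemannZeta s = Gammaℝ s * riemannZeta s := by
    rw [riemannZeta_def_of_ne_zero hs0, mul_div_cancel₀ _ (Gammaℝ_ne_zero_of_re_pos hre)]
  have hξ : riemannXi s = s * (s - 1) / 2 * ((π : ℂ) ^ (-s / 2) * Complex.Gamma (s / 2)) *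
      riemannZeta s := by
    rw [riemannXi_eq_mul_completedRiemannZeta hs0 hs1, hΛ, Gammaℝ_def]
    ring
  -- norms of the factors
  have hnorm_s : ‖s‖ ≤ 1 + |t| := by
    refine (norm_le_abs_re_add_abs_im s).trans ?_
    rw [hsre, hsim]; norm_num
  have hnorm_s1 : ‖s - 1‖ = ‖s‖ := by
    have : s - 1 = -(starRingEnd ℂ s) := by
      apply Complex.ext <;> norm_num [hs]
    rw [this, norm_neg, Complex.norm_conj]
  have hnorm_pi : ‖(π : ℂ) ^ (-s / 2)‖ ≤ 1 := by
    rw [Complex.norm_cpow_eq_rpow_re_of_pos Real.pi_pos]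
    have : (-s / 2).re = -(1 / 4 : ℝ) := by rw [neg_div, neg_re, div_ofNat_re, hsre]; norm_num
    rw [this]
    exact Real.rpow_le_one_of_one_le_of_nonpos (by linarith [Real.pi_gt_three]) (by norm_num)
  have hG : ‖Complex.Gamma (s / 2)‖ ≤ 16 * π ^ 2 * (1 + |t|) * Real.exp (-(π * |t|) / 4) := by
    have hs2 : s / 2 = ((1 / 4 : ℝ) : ℂ) + ((t / 2 : ℝ) : ℂ) * I := by
      rw [hs]; push_cast; ring
    have ht2 : 1 ≤ |t / 2| := by rw [abs_div, abs_two]; linarith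
    have h := Literature.Analysis.SpecialFunctions.norm_Gamma_le_exp (x := 1 / 4) (y := t / 2)
      (by norm_num) (by norm_num) ht2
    rw [hs2]
    refine h.trans ?_
    have habs : |t / 2| = |t| / 2 := by rw [abs_div, abs_two]
    rw [habs]
    have hexp : Real.exp (-(π * (|t| / 2)) / 2) = Real.exp (-(π * |t|) / 4) := by
      congr 1; ring
    rw [hexp]
    have hbase : 1 ≤ 1 + |t| / 2 := by linarith [abs_nonneg t]
    have hsqrt : (1 + |t| / 2) ^ (1 / 2 : ℝ) ≤ 1 + |t| := by
      calc (1 + |t| / 2) ^ (1 / 2 : ℝ) ≤ (1 + |t| / 2) ^ (1 : ℝ) :=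
            Real.rpow_le_rpow_of_exponent_le hbase (by norm_num)
        _ = 1 + |t| / 2 := Real.rpow_one _
        _ ≤ 1 + |t| := by linarith [abs_nonneg t]
    have hπ : 0 ≤ 16 * π ^ 2 := by positivity
    exact mul_le_mul_of_nonneg_right (mul_le_mul_of_nonneg_left hsqrt hπ) (Real.exp_pos _).le
  have hζ : ‖riemannZeta s‖ ≤ 3 * (1 + |t|) := by
    have h := norm_riemannZeta_le_of_re_pos hre hs1
    rw [hnorm_s1, hsre, div_self (norm_ne_zero_iff.mpr hs0)] at h
    calc ‖riemannZeta s‖ ≤ 1 + ‖s‖ / (1 / 2) := h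
      _ = 1 + 2 * ‖s‖ := by ring
      _ ≤ 3 * (1 + |t|) := by linarith [abs_nonneg t]
  -- assemble
  have hpoly : ‖s * (s - 1) / 2‖ ≤ (1 + |t|) ^ 2 / 2 := by
    rw [norm_div, norm_mul, hnorm_s1, Complex.norm_two]
    have : ‖s‖ * ‖s‖ ≤ (1 + |t|) * (1 + |t|) :=
      mul_le_mul hnorm_s hnorm_s (norm_nonneg _) (by linarith [abs_nonneg t])
    nlinarith
  have ht0 := abs_nonneg t
  rw [hξ, norm_mul, norm_mul, norm_mul]
  have h1 : ‖(π : ℂ) ^ (-s / 2)‖ * ‖Complex.Gamma (s / 2)‖ ≤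
      1 * (16 * π ^ 2 * (1 + |t|) * Real.exp (-(π * |t|) / 4)) :=
    mul_le_mul hnorm_pi hG (norm_nonneg _) zero_le_one
  have h2 : ‖s * (s - 1) / 2‖ * (‖(π : ℂ) ^ (-s / 2)‖ * ‖Complex.Gamma (s / 2)‖) ≤
      (1 + |t|) ^ 2 / 2 * (1 * (16 * π ^ 2 * (1 + |t|) * Real.exp (-(π * |t|) / 4))) :=
    mul_le_mul hpoly h1 (by positivity) (by positivity)
  have h3 := mul_le_mul h2 hζ (norm_nonneg _) (by positivity)
  refine h3.trans_eq ?_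
  ring

/-- `t ↦ ξ(½ + it)` is continuous (`ξ` is entire). [folklore] -/
theorem continuous_riemannXi_criticalLine : Continuous fun t : ℝ ↦ riemannXi (1 / 2 + t * I) := by
  have hξ : Continuous riemannXi := differentiable_riemannXi.continuous
  fun_prop

/-- `Ξ` is even: `ξ(½ − it) = ξ(½ + it)` (functional equation `ξ(1 − s) = ξ(s)`). [folklore] -/
theorem riemannXi_criticalLine_neg (t : ℝ) :
    riemannXi (1 / 2 + ↑(-t) * I) = riemannXi (1 / 2 + t * I) := by
  rw [← riemannXi_one_sub (1 / 2 + t * I)]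
  congr 1
  push_cast
  ring

/-- `ξ(½ + it) = O(e^{-t/2})` as `t → +∞` (from `norm_riemannXi_criticalLine_le`, `π/4 > 1/2`).
[folklore] -/
theorem isBigO_riemannXi_criticalLine :
    (fun t : ℝ ↦ riemannXi (1 / 2 + t * I)) =O[atTop] fun t : ℝ ↦ Real.exp (-(1 / 2) * t) := by
  -- first: `O((1+t)⁴ e^{-πt/4})`
  have h1 : (fun t : ℝ ↦ riemannXi (1 / 2 + t * I)) =O[atTop]
      fun t : ℝ ↦ (1 + t) ^ 4 * Real.exp (-(π / 4) * t) := by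
    refine IsBigO.of_bound (24 * π ^ 2) ?_
    filter_upwards [eventually_ge_atTop (2 : ℝ)] with t ht
    have ht0 : 0 ≤ t := by linarith
    have habs : |t| = t := abs_of_nonneg ht0
    have h := norm_riemannXi_criticalLine_le (t := t) (by rw [habs]; exact ht)
    rw [habs] at h
    have hpos : 0 < (1 + t) ^ 4 * Real.exp (-(π / 4) * t) := by positivity
    rw [Real.norm_of_nonneg hpos.le]
    calc ‖riemannXi (1 / 2 + ↑t * I)‖ ≤ 24 * π ^ 2 * (1 + t) ^ 4 * Real.exp (-(π * t) / 4) := h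
      _ = 24 * π ^ 2 * ((1 + t) ^ 4 * Real.exp (-(π / 4) * t)) := by
          rw [show -(π * t) / 4 = -(π / 4) * t by ring]; ring
  -- second: `(1+t)⁴ e^{-πt/4} = o(e^{-t/2})`
  have hb : 0 < π / 4 - 1 / 2 := by linarith [Real.pi_gt_three]
  have h2 : (fun t : ℝ ↦ (1 + t) ^ 4 * Real.exp (-(π / 4) * t)) =o[atTop]
      fun t : ℝ ↦ Real.exp (-(1 / 2) * t) := by
    refine isLittleO_of_tendsto (fun t h ↦ absurd h (Real.exp_pos _).ne') ?_
    -- the ratio is `(1+t)⁴ e^{-(π/4 - 1/2) t}`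
    have hratio : ∀ t : ℝ, (1 + t) ^ 4 * Real.exp (-(π / 4) * t) / Real.exp (-(1 / 2) * t) =
        (1 + t) ^ 4 * Real.exp (-(π / 4 - 1 / 2) * t) := by
      intro t
      rw [mul_div_assoc, ← Real.exp_sub]
      congr 2; ring
    simp_rw [hratio]
    -- compare with `u ^ 4 e^{-b u}` after the shift `u = 1 + t`
    have h3 : Tendsto (fun u : ℝ ↦ u ^ 4 * Real.exp (-(π / 4 - 1 / 2) * u)) atTop (𝓝 0) := by
      have h := tendsto_rpow_mul_exp_neg_mul_atTop_nhds_zero 4 _ hb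
      refine h.congr fun u ↦ ?_
      rw [Real.rpow_ofNat]
    have h4 : Tendsto (fun t : ℝ ↦ (1 + t) ^ 4 * Real.exp (-(π / 4 - 1 / 2) * (1 + t)))
        atTop (𝓝 0) :=
      h3.comp (tendsto_atTop_add_const_left atTop 1 tendsto_id)
    have h5 : Tendsto (fun t : ℝ ↦ Real.exp (π / 4 - 1 / 2) *
        ((1 + t) ^ 4 * Real.exp (-(π / 4 - 1 / 2) * (1 + t)))) atTop (𝓝 0) := by
      simpa using h4.const_mul (Real.exp (π / 4 - 1 / 2))
    refine h5.congr fun t ↦ ?_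
    have hcc : Real.exp (π / 4 - 1 / 2) * Real.exp (-(π / 4 - 1 / 2)) = 1 := by
      rw [← Real.exp_add, add_neg_cancel, Real.exp_zero]
    rw [show -(π / 4 - 1 / 2) * (1 + t) = -(π / 4 - 1 / 2) * t + -(π / 4 - 1 / 2) by ring,
      Real.exp_add]
    calc Real.exp (π / 4 - 1 / 2) * ((1 + t) ^ 4 * (Real.exp (-(π / 4 - 1 / 2) * t) *
          Real.exp (-(π / 4 - 1 / 2))))
        = (1 + t) ^ 4 * Real.exp (-(π / 4 - 1 / 2) * t) *
          (Real.exp (π / 4 - 1 / 2) * Real.exp (-(π / 4 - 1 / 2))) := by ring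
      _ = (1 + t) ^ 4 * Real.exp (-(π / 4 - 1 / 2) * t) := by rw [hcc, mul_one]
  exact h1.trans_isLittleO h2 |>.isBigO

/-- `t ↦ ξ(½ + it)` is integrable on `(0, ∞)` (exponential decay, Step 2). [folklore] -/
theorem integrableOn_riemannXi_criticalLine_Ioi :
    IntegrableOn (fun t : ℝ ↦ riemannXi (1 / 2 + t * I)) (Ioi 0) := by
  have hc := continuous_riemannXi_criticalLine
  have hnorm : IntegrableOn (fun t : ℝ ↦ ‖riemannXi (1 / 2 + t * I)‖) (Ioi 0) :=
    integrable_of_isBigO_exp_neg (by norm_num : (0 : ℝ) < 1 / 2)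
      (hc.norm.continuousOn) isBigO_riemannXi_criticalLine.norm_left
  exact (integrable_norm_iff hc.aestronglyMeasurable.restrict).mp hnorm

/-- `t ↦ ξ(½ + it)` is integrable on `(-∞, 0]` (by evenness). [folklore] -/
theorem integrableOn_riemannXi_criticalLine_Iic :
    IntegrableOn (fun t : ℝ ↦ riemannXi (1 / 2 + t * I)) (Iic 0) := by
  rw [← Measure.map_neg_eq_self (volume : Measure ℝ)]
  let m : MeasurableEmbedding fun x : ℝ ↦ -x := (Homeomorph.neg ℝ).measurableEmbedding
  rw [m.integrableOn_map_iff]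
  simp_rw [Function.comp_def, neg_preimage, neg_Iic, neg_zero]
  refine Iff.mpr integrableOn_Ici_iff_integrableOn_Ioi
    (integrableOn_riemannXi_criticalLine_Ioi.congr_fun (fun u _ ↦ ?_) measurableSet_Ioi)
  exact (riemannXi_criticalLine_neg u).symm

/-- **`Ξ ∈ L¹(ℝ)`**: `t ↦ ξ(½ + it)` is integrable on `ℝ`. [folklore] -/
theorem integrable_riemannXi_criticalLine :
    Integrable (fun t : ℝ ↦ riemannXi (1 / 2 + t * I)) := by
  rw [← integrableOn_univ, ← Iic_union_Ioi (a := (0 : ℝ)), integrableOn_union]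
  exact ⟨integrableOn_riemannXi_criticalLine_Iic, integrableOn_riemannXi_criticalLine_Ioi⟩

/-! ## Step 3: Fourier inversion at `0`: `∫_ℝ Ξ = 4πΦ(0)`, `∫₀^∞ Ξ = 2πΦ(0) = A₀` -/

/-- **`∫_ℝ ξ(½ + it) dt = 4π Φ(0)`** (Fourier inversion of `𝓕Φ = Ξ(π·)/4` at `0`; equivalently
LM Thm. 2.1 (1): `∫₀^∞ Ξ = πΦ_T(0)`). [cite: LagariasMontague2011, Thm. 2.1 (1)] -/
theorem integral_riemannXi_criticalLine :
    ∫ t : ℝ, riemannXi (1 / 2 + t * I) = 4 * π * deBruijnPhi 0 := by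
  set φ : ℝ → ℂ := fun u ↦ (deBruijnPhi u : ℂ) with hφ
  have hφi : Integrable φ := by
    simpa [hφ] using integrable_exp_mul_deBruijnPhi 0
  have hφc : Continuous φ := continuous_ofReal.comp continuous_deBruijnPhi
  have h𝓕 : 𝓕 φ = fun w : ℝ ↦ riemannXi (1 / 2 + ↑(π * w) * I) / 4 :=
    funext fourier_deBruijnPhi
  have hΞ := integrable_riemannXi_criticalLine
  have h𝓕i : Integrable (𝓕 φ) := by
    rw [h𝓕]
    exact (hΞ.comp_mul_left' Real.pi_ne_zero).div_const 4
  have hinv := hφi.fourierInv_fourier_eq h𝓕i (hφc.continuousAt (x := 0))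
  have hinv0 : 𝓕⁻ (𝓕 φ) 0 = ∫ w : ℝ, 𝓕 φ w := by
    simp [fourierInv_eq]
  rw [hinv0, h𝓕, integral_div] at hinv
  have hsub : ∫ w : ℝ, riemannXi (1 / 2 + ↑(π * w) * I) =
      (π : ℂ)⁻¹ * ∫ t : ℝ, riemannXi (1 / 2 + t * I) := by
    have h := Measure.integral_comp_mul_left (fun t : ℝ ↦ riemannXi (1 / 2 + t * I)) π
    simp only [abs_of_pos (inv_pos.mpr Real.pi_pos), Complex.real_smul, ofReal_inv] at h
    exact h
  rw [hsub] at hinv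
  have hφ0 : φ 0 = (deBruijnPhi 0 : ℂ) := rfl
  rw [hφ0] at hinv
  have hπ : (π : ℂ) ≠ 0 := ofReal_ne_zero.mpr Real.pi_ne_zero
  set X : ℂ := ∫ t : ℝ, riemannXi (1 / 2 + t * I) with hX
  have h4 : X = 4 * π * ((π : ℂ)⁻¹ * X / 4) := by
    field_simp
  rw [hinv] at h4
  exact h4

/-- **Lagarias–Montague Thm. 2.1 (1), integral form**: `∫₀^∞ ξ(½ + it) dt = A₀ = 2πΦ(0)`
(`= πΦ_T(0)`, `xiIntegralLimit`). [cite: LagariasMontague2011, Thm. 2.1 (1)] -/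
theorem integral_riemannXi_criticalLine_Ioi :
    ∫ t in Ioi (0 : ℝ), riemannXi (1 / 2 + t * I) = (xiIntegralLimit : ℂ) := by
  set F : ℝ → ℂ := fun t ↦ riemannXi (1 / 2 + t * I) with hF
  have hIoi := integrableOn_riemannXi_criticalLine_Ioi
  have hIic := integrableOn_riemannXi_criticalLine_Iic
  have h1 : ∫ t : ℝ, F t = (∫ t in Iic (0 : ℝ), F t) + ∫ t in Ioi (0 : ℝ), F t := by
    rw [← setIntegral_union (Iic_disjoint_Ioi le_rfl) measurableSet_Ioi hIic hIoi,
      Iic_union_Ioi, Measure.restrict_univ]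
  have h2 : ∫ t in Iic (0 : ℝ), F t = ∫ t in Ioi (0 : ℝ), F t := by
    rw [← neg_zero, ← integral_comp_neg_Iic, neg_zero]
    refine setIntegral_congr_fun measurableSet_Iic fun u _ ↦ ?_
    exact (riemannXi_criticalLine_neg u).symm
  have h3 := integral_riemannXi_criticalLine
  rw [h1, h2, ← two_mul] at h3
  rw [xiIntegralLimit]
  push_cast
  linear_combination h3 / 2

/-! ## Step 4: assembly -/

/-- On the critical line `ξ^{(-1)}(½ + it) = i ∫₀ᵗ ξ(½ + iv) dv` (substitute `u ↦ ut` in the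
segment parametrisation; LM Lemma 3.2 (3): `Ξ₀^{(-1)}(z) = −i ξ^{(-1)}(½ + iz)`).
[cite: LagariasMontague2011, Lemma 3.2 (3)] -/
theorem xiIntegral_criticalLine (t : ℝ) :
    xiIntegral (1 / 2 + t * I) = I * ∫ v in (0 : ℝ)..t, riemannXi (1 / 2 + v * I) := by
  set F : ℝ → ℂ := fun v ↦ riemannXi (1 / 2 + v * I) with hF
  rw [xiIntegral]
  have hs : (1 / 2 + (t : ℂ) * I) - 1 / 2 = t * I := by ring
  rw [hs]
  have hint : ∀ u : ℝ, riemannXi (1 / 2 + (u : ℂ) * ((t : ℂ) * I)) = F (u * t) := by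
    intro u; simp only [hF]; push_cast; ring_nf
  simp_rw [hint]
  have hsub := intervalIntegral.smul_integral_comp_mul_right F t (a := 0) (b := 1)
  rw [zero_mul, one_mul] at hsub
  rw [← hsub, Complex.real_smul]
  ring

/-- **Discharge of `Literature.NumberTheory.LFunctions.LagariasMontague2011_thm_2_1_i`**
(Lagarias–Montague 2011, Thm. 2.1 (1) with `λ = 0`, and eq. (2.6)):
`lim_{t→+∞} ξ^{(-1)}(½ + it) = iA₀` and `lim_{t→−∞} ξ^{(-1)}(½ + it) = −iA₀`, `A₀ = 2πΦ(0) = πΦ_T(0)`.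
[cite: LagariasMontague2011, Thm. 2.1 (1)] -/
theorem LagariasMontague2011_thm_2_1_i_holds : LagariasMontague2011_thm_2_1_i := by
  set F : ℝ → ℂ := fun v ↦ riemannXi (1 / 2 + v * I) with hF
  have hlim : Tendsto (fun t : ℝ ↦ ∫ v in (0 : ℝ)..t, F v) atTop (𝓝 (xiIntegralLimit : ℂ)) := by
    rw [← integral_riemannXi_criticalLine_Ioi]
    exact intervalIntegral_tendsto_integral_Ioi 0 integrableOn_riemannXi_criticalLine_Ioi tendsto_id
  have heq : (fun t : ℝ ↦ xiIntegral (1 / 2 + t * I)) = fun t ↦ I * ∫ v in (0 : ℝ)..t, F v :=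
    funext xiIntegral_criticalLine
  refine ⟨?_, ?_⟩
  · rw [heq, show (xiIntegralLimit : ℂ) * I = I * xiIntegralLimit from mul_comm _ _]
    exact hlim.const_mul I
  · have hodd : ∀ t : ℝ, ∫ v in (0 : ℝ)..t, F v = -∫ v in (0 : ℝ)..(-t), F v := by
      intro t
      have h1 : ∫ v in (0 : ℝ)..t, F v = ∫ v in (0 : ℝ)..t, F (-v) := by
        refine intervalIntegral.integral_congr fun v _ ↦ ?_
        simp only [hF]
        exact (riemannXi_criticalLine_neg v).symm
      rw [h1, intervalIntegral.integral_comp_neg, neg_zero, intervalIntegral.integral_symm]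
    have hlim' : Tendsto (fun t : ℝ ↦ ∫ v in (0 : ℝ)..t, F v) atBot (𝓝 (-(xiIntegralLimit : ℂ))) := by
      have := (hlim.comp tendsto_neg_atBot_atTop).neg
      refine this.congr fun t ↦ ?_
      simp only [Function.comp_apply]
      exact (hodd t).symm
    rw [heq, show -((xiIntegralLimit : ℂ) * I) = I * -(xiIntegralLimit : ℂ) by ring]
    exact hlim'.const_mul I

/-- **Discharge of `Literature.NumberTheory.LFunctions.LagariasMontague2011_thm21_limit`** (the
`XiPrimitive.lean` vendoring of LM Thm. 2.1 (1), `t → +∞` limit). [cite: LagariasMontague2011, Thm. 2.1 (1)] -/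
theorem LagariasMontague2011_thm21_limit_holds : LagariasMontague2011_thm21_limit :=
  LagariasMontague2011_thm21_limit_of_thm_2_1_i LagariasMontague2011_thm_2_1_i_holds

/-- The `RiemannXiPrimitive.lean` vendoring of the constant `A₀ = πΦ_T(0)` agrees with
`xiIntegralLimit = 2π·deBruijnPhi 0`. [folklore] -/
theorem LagariasMontague.A₀_eq_xiIntegralLimit : LagariasMontague.A₀ = xiIntegralLimit := by
  rw [← lmA0_eq_xiIntegralLimit, LagariasMontague.A₀, lmA0, lmPhiZero]
  congr 1
  refine tsum_congr fun n ↦ ?_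
  rw [neg_mul]

/-- The `RiemannXiPrimitive.lean` vendoring of `ξ^{(-1)}` is `xiIntegral` (definitionally). [folklore] -/
theorem riemannXiPrimitive_eq_xiIntegral : riemannXiPrimitive = xiIntegral := rfl

/-- **Discharge of `Literature.NumberTheory.LFunctions.tendsto_riemannXiPrimitive_criticalLine_LM`**
(the `RiemannXiPrimitive.lean` vendoring of LM Thm. 2.1 (1): `A₀ ≠ 0` — indeed `A₀ = 2πΦ(0) > 0` by
`deBruijnPhi_pos_holds` — and `ξ^{(-1)}(½ + it) → iA₀`). [cite: LagariasMontague2011, Thm. 2.1 (1)] -/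
theorem tendsto_riemannXiPrimitive_criticalLine_LM_holds :
    tendsto_riemannXiPrimitive_criticalLine_LM := by
  refine ⟨?_, ?_⟩
  · rw [LagariasMontague.A₀_eq_xiIntegralLimit, xiIntegralLimit]
    have := deBruijnPhi_pos_holds 0
    positivity
  · rw [LagariasMontague.A₀_eq_xiIntegralLimit, riemannXiPrimitive_eq_xiIntegral]
    exact LagariasMontague2011_thm_2_1_i_holds.1

end Literature.NumberTheory.LFunctions
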